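import Summits.Ventures.Crystal3D.Theorems.StickyWulffConstantCoaxialWallLawVicinalSplit
import Summits.Ventures.Crystal3D.Theorems.StickyWulffConstantGenericWallFloorCapperRiseSharp
import Summits.Ventures.Crystal3D.Theorems.StickyWulffConstantCoaxialWallLawChainTorsionLedger
import HarnessLib

/-!
# Vicinal coherence: in the vicinal core every level-⅓ pair is COHERENT (crux `CoaxialWallLaw`, stmt-Ventures-19481,
# line `WallLedgerF`)

HONEST FRAMING. Venture `Summits/Ventures/Crystal3D` (cell `crystal3d-full`), helper `--supports` the crux `CoaxialWallLaw`
of `route-Ventures-StickyWulffConstant` (REGISTERED line `WallLedgerF`, open stub `stub_coaxialTwoSlabAdhesion`).  Pure lattice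
geometry; rung credit; F-C1 not moved; NOT the crux; no census.

The vicinal core (`…VicinalCore`, `…VicinalSplit`) asks, at level ⅓, that the offset be REGISTERED — inside the two fault cosets
`A₁·(Λ₀ + ℤ√(2/3)n₁ + ℤ√(2/3)n₂)` — for every slot of `e₃`-component `≥ 9/20` dominating an admissible axis.  This file shows
that two such registrations for two ADJACENT rising slots of one menu normal `ν` already force the offset into the DSC
lattice `A₁·(Λ₀ + ℤ√(2/3)ν)`:

* **`coherentOffset_of_two_registrations`** — slots `uᵢ, uⱼ` with `⟪uᵢ,uⱼ⟫ = ½`, both rising out of `ν`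
  (`⟪A₁u, ν⟫ = √(2/3)`), offset registered for both ⇒ `A₁⁻¹(v − a√(2/3)ν) ∈ Λ₀` for some `a ∈ ℤ` (pair both lattice vectors
  with the slot `uᵢ + 2uⱼ − √6·A₁⁻¹ν`, which kills `ν` and `uᵢ` and sees `uⱼ` at `½`: `3 ∣ bⱼ`);
* **`two_good_of_moments`** — the real-variable lemma: three numbers `cₖ ∈ [0, min(1, √(3/2)c)]` with `Σcₖ = √6 c` and
  `Σcₖ² = (1 + 3c²)/2` have their two largest `≥ ½` with `2cₖ² ≥ 1 − c²`;
* **`two_good_rising_slots`** — hence, for a unit menu normal `ν` whose three rising slots `A₁uₖ` have `e₃`-components in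
  `[0, √(3/2)⟪ν,e₃⟫]` (true for the axis NEAREST to `e₃`, and for a vicinal twin axis), two of the three rising slots have
  `e₃`-component `≥ ½ ≥ 9/20` and dominate `ν` (`√(1 − ⟪ν,e₃⟫²) ≤ √2·⟪A₁u, e₃⟫`).
The sequel files apply this to twins (vicinal ⇒ coherent Σ3) and to translation pairs (⇒ basal stacking fault of the nearest
axis): the INCOHERENT debt of `…VicinalSplit` contains no level-⅓ pair at all.
WHAT THIS IS NOT: not the stub; F-C1 not moved.
-/

noncomputable section

namespace Summit.Ventures.Crystal3D.Theorems

open Summit.Ventures.Crystal3D Finset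
open Literature.MathematicalPhysics.StatisticalMechanics (fccStacking barlowStacking IsHaggSeq contactDeficiency)
open scoped InnerProductSpace

/-! ### Two registrations for two adjacent rising slots force a DSC offset -/

/-- **Two adjacent rising slots registered ⇒ the offset is in the DSC lattice `A₁·(Λ₀ + ℤ√(2/3)ν)`.** -/
theorem coherentOffset_of_two_registrations
    (A₁ : EuclideanSpace ℝ (Fin 3) ≃ₗᵢ[ℝ] EuclideanSpace ℝ (Fin 3)) {v ν uᵢ uⱼ : EuclideanSpace ℝ (Fin 3)}
    (hν : ‖ν‖ = 1)
    (hmenu : ∀ w ∈ fccSlots, ⟪A₁ w, ν⟫_ℝ = 0 ∨ ⟪A₁ w, ν⟫_ℝ = Real.sqrt (2 / 3) ∨ ⟪A₁ w, ν⟫_ℝ = -Real.sqrt (2 / 3))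
    (huᵢ : uᵢ ∈ fccSlots) (huⱼ : uⱼ ∈ fccSlots) (hij : ⟪uᵢ, uⱼ⟫_ℝ = 1 / 2)
    (hiν : ⟪A₁ uᵢ, ν⟫_ℝ = Real.sqrt (2 / 3)) (hjν : ⟪A₁ uⱼ, ν⟫_ℝ = Real.sqrt (2 / 3))
    (hRi : ∃ a b : ℤ, A₁.symm (v - (a : ℝ) • (Real.sqrt (2 / 3) • ν) -
      (b : ℝ) • (Real.sqrt (2 / 3) • ((2 * Real.sqrt (2 / 3)) • A₁ uᵢ - ν))) ∈ fccStacking 1 (Real.sqrt (2 / 3)))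
    (hRj : ∃ a b : ℤ, A₁.symm (v - (a : ℝ) • (Real.sqrt (2 / 3) • ν) -
      (b : ℝ) • (Real.sqrt (2 / 3) • ((2 * Real.sqrt (2 / 3)) • A₁ uⱼ - ν))) ∈ fccStacking 1 (Real.sqrt (2 / 3))) :
    ∃ a : ℤ, A₁.symm (v - (a : ℝ) • (Real.sqrt (2 / 3) • ν)) ∈ fccStacking 1 (Real.sqrt (2 / 3)) := by
  obtain ⟨aᵢ, bᵢ, hLi⟩ := hRi
  obtain ⟨aⱼ, bⱼ, hLj⟩ := hRj
  have h23 : Real.sqrt (2 / 3) * Real.sqrt (2 / 3) = 2 / 3 := Real.mul_self_sqrt (by norm_num)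
  have h6pos : 0 < Real.sqrt 6 := Real.sqrt_pos.2 (by norm_num)
  have h62 : Real.sqrt 6 * Real.sqrt (2 / 3) = 2 := by
    rw [← Real.sqrt_mul (by norm_num), show (6 : ℝ) * (2 / 3) = 2 ^ 2 by norm_num, Real.sqrt_sq (by norm_num)]
  -- the lattice vector `y = √6·A₁⁻¹ν`
  obtain ⟨y, hy, hAy⟩ := exists_lattice_eq_sqrt6_menu A₁ hmenu
  have huᵢΛ := mem_fcc_of_mem_fccSlots huᵢ
  have huⱼΛ := mem_fcc_of_mem_fccSlots huⱼ
  have nuᵢ : ⟪uᵢ, uᵢ⟫_ℝ = 1 := by rw [real_inner_self_eq_norm_sq, norm_eq_one_of_mem_fccSlots huᵢ, one_pow]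
  have nuⱼ : ⟪uⱼ, uⱼ⟫_ℝ = 1 := by rw [real_inner_self_eq_norm_sq, norm_eq_one_of_mem_fccSlots huⱼ, one_pow]
  have hyy : ⟪y, y⟫_ℝ = 6 := by
    rw [← A₁.inner_map_map, hAy, real_inner_smul_left, real_inner_smul_right, real_inner_self_eq_norm_sq, hν]
    have : Real.sqrt 6 * Real.sqrt 6 = 6 := Real.mul_self_sqrt (by norm_num)
    rw [one_pow, mul_one, this]
  have hiy : ⟪uᵢ, y⟫_ℝ = 2 := by rw [← A₁.inner_map_map, hAy, real_inner_smul_right, hiν, h62]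
  have hjy : ⟪uⱼ, y⟫_ℝ = 2 := by rw [← A₁.inner_map_map, hAy, real_inner_smul_right, hjν, h62]
  have hji : ⟪uⱼ, uᵢ⟫_ℝ = 1 / 2 := by rw [real_inner_comm, hij]
  -- the pairing slot `s' = uᵢ + 2uⱼ − y`
  set s' : EuclideanSpace ℝ (Fin 3) := uᵢ + (2 : ℝ) • uⱼ - y with hs'
  have hs'Λ : s' ∈ fccStacking 1 (Real.sqrt (2 / 3)) := by
    have h2 := fcc_zsmul_mem 2 huⱼΛ
    push_cast at h2
    exact fcc_sub_site_mem (fcc_add_site_mem huᵢΛ h2) hy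
  have hs'i : ⟪s', uᵢ⟫_ℝ = 0 := by
    rw [hs', inner_sub_left, inner_add_left, real_inner_smul_left, nuᵢ, hji, real_inner_comm, hiy]; norm_num
  have hs'j : ⟪s', uⱼ⟫_ℝ = 1 / 2 := by
    rw [hs', inner_sub_left, inner_add_left, real_inner_smul_left, hij, nuⱼ, real_inner_comm, hjy]; norm_num
  have hs'y : ⟪s', y⟫_ℝ = 0 := by
    rw [hs', inner_sub_left, inner_add_left, real_inner_smul_left, hiy, hjy, hyy]; norm_num
  have hs'norm : ‖s'‖ = 1 := by
    have h : ⟪s', s'⟫_ℝ = 1 := by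
      conv_lhs => rw [show s' = uᵢ + (2 : ℝ) • uⱼ - y from hs']
      rw [inner_sub_right, inner_add_right, real_inner_smul_right, hs'i, hs'j, hs'y]; norm_num
    rw [real_inner_self_eq_norm_sq] at h
    nlinarith [norm_nonneg s']
  have hs'slot : s' ∈ fccSlots := mem_fccSlots_of_unit hs'Λ hs'norm
  -- inner products of the registered lattice vectors with `s'`
  have hνs : ⟪ν, A₁ s'⟫_ℝ = 0 := by
    have h : ⟪A₁ y, A₁ s'⟫_ℝ = 0 := by rw [A₁.inner_map_map, real_inner_comm, hs'y]
    rw [hAy, real_inner_smul_left] at h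
    rcases mul_eq_zero.1 h with h | h
    · exact absurd h h6pos.ne'
    · exact h
  have key : ∀ (a b : ℤ) (u : EuclideanSpace ℝ (Fin 3)),
      ⟪A₁.symm (v - (a : ℝ) • (Real.sqrt (2 / 3) • ν) - (b : ℝ) • (Real.sqrt (2 / 3) • ((2 * Real.sqrt (2 / 3)) • A₁ u - ν))),
        s'⟫_ℝ = ⟪A₁.symm v, s'⟫_ℝ - (b : ℝ) * (4 / 3) * ⟪u, s'⟫_ℝ := by
    intro a b u
    have e1 : ∀ X : EuclideanSpace ℝ (Fin 3), ⟪A₁.symm X, s'⟫_ℝ = ⟪X, A₁ s'⟫_ℝ := by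
      intro X; rw [← A₁.inner_map_map (A₁.symm X) s', LinearIsometryEquiv.apply_symm_apply]
    rw [e1, e1]
    simp only [inner_sub_left, real_inner_smul_left, hνs, LinearIsometryEquiv.inner_map_map]
    linear_combination (-2 * (b : ℝ) * ⟪u, s'⟫_ℝ) * h23
  obtain ⟨kᵢ, hkᵢ⟩ := exists_int_two_inner_slot hLi hs'slot
  obtain ⟨kⱼ, hkⱼ⟩ := exists_int_two_inner_slot hLj hs'slot
  rw [key, real_inner_comm s' uᵢ, hs'i] at hkᵢ
  rw [key, real_inner_comm s' uⱼ, hs'j] at hkⱼ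
  -- `3 ∣ bⱼ`
  have hdiv : (4 : ℝ) * bⱼ = 3 * ((kᵢ : ℝ) - kⱼ) := by linarith
  have hdivZ : 4 * bⱼ = 3 * (kᵢ - kⱼ) := by exact_mod_cast hdiv
  obtain ⟨q, hq⟩ : ∃ q : ℤ, bⱼ = 3 * q := ⟨kᵢ - kⱼ - bⱼ, by omega⟩
  -- the DSC representative
  refine ⟨aⱼ - bⱼ, ?_⟩
  have hA : A₁.symm (A₁ uⱼ) = uⱼ := LinearIsometryEquiv.symm_apply_apply A₁ uⱼ
  have h43 : Real.sqrt (2 / 3) • ((2 * Real.sqrt (2 / 3)) • uⱼ) = (4 / 3 : ℝ) • uⱼ := by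
    rw [smul_smul, show Real.sqrt (2 / 3) * (2 * Real.sqrt (2 / 3)) = 4 / 3 by nlinarith [h23]]
  have hb : (bⱼ : ℝ) = 3 * (q : ℝ) := by exact_mod_cast hq
  have hdecomp : A₁.symm (v - ((aⱼ - bⱼ : ℤ) : ℝ) • (Real.sqrt (2 / 3) • ν)) =
      A₁.symm (v - (aⱼ : ℝ) • (Real.sqrt (2 / 3) • ν) -
        (bⱼ : ℝ) • (Real.sqrt (2 / 3) • ((2 * Real.sqrt (2 / 3)) • A₁ uⱼ - ν))) + ((4 * q : ℤ) : ℝ) • uⱼ := by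
    simp only [map_sub, map_smul, hA]
    rw [smul_sub (Real.sqrt (2 / 3)) ((2 * Real.sqrt (2 / 3)) • uⱼ) (A₁.symm ν), h43]
    push_cast
    rw [hb]
    module
  rw [hdecomp]
  exact fcc_add_site_mem hLj (fcc_zsmul_mem _ huⱼΛ)

/-! ### The real-variable lemma: two of three are good -/

/-- **Two of three are good.**  Reals `c₁, c₂ ≥ c₃ ≥ 0`, `cₖ ≤ 1`, `2cₖ² ≤ 3c²` (`k = 1, 2`), `c₁ + c₂ + c₃ = √6·c`,
`c₁² + c₂² + c₃² = (1 + 3c²)/2` ⇒ `c₂ ≥ ½` and `1 − c² ≤ 2c₂²` (and symmetrically for `c₁`). -/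
theorem two_good_of_moments {c c₁ c₂ c₃ : ℝ} (hc : 0 ≤ c)
    (h3₁ : c₃ ≤ c₁) (h3₂ : c₃ ≤ c₂) (h30 : 0 ≤ c₃) (h1₁ : c₁ ≤ 1)
    (hc₁ : 2 * c₁ ^ 2 ≤ 3 * c ^ 2) (hc₂ : 2 * c₂ ^ 2 ≤ 3 * c ^ 2)
    (hsum : c₁ + c₂ + c₃ = Real.sqrt 6 * c) (hsq : c₁ ^ 2 + c₂ ^ 2 + c₃ ^ 2 = (1 + 3 * c ^ 2) / 2) :
    1 / 2 ≤ c₂ ∧ 1 - c ^ 2 ≤ 2 * c₂ ^ 2 := by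
  have hc₁0 : 0 ≤ c₁ := h30.trans h3₁
  have hc₂0 : 0 ≤ c₂ := h30.trans h3₂
  set r : ℝ := Real.sqrt 6 with hr
  have hr6 : r ^ 2 = 6 := by rw [hr]; exact Real.sq_sqrt (by norm_num)
  have hr0 : 0 ≤ r := Real.sqrt_nonneg 6
  have hrc : 0 ≤ r * c := mul_nonneg hr0 hc
  -- `2cₖ ≤ r c`
  have hc₁' : 2 * c₁ ≤ r * c := by
    have h : (2 * c₁) ^ 2 ≤ (r * c) ^ 2 := by nlinarith only [hc₁, hr6]
    exact (pow_le_pow_iff_left₀ (by linarith) hrc two_ne_zero).1 h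
  have hc₂' : 2 * c₂ ≤ r * c := by
    have h : (2 * c₂) ^ 2 ≤ (r * c) ^ 2 := by nlinarith only [hc₂, hr6]
    exact (pow_le_pow_iff_left₀ (by linarith) hrc two_ne_zero).1 h
  -- `Q = c₂² + c₃² ≥ 1/2`, `c₃² ≤ c₂²`
  have hQ : 1 / 2 ≤ c₂ ^ 2 + c₃ ^ 2 := by linarith only [hsq, hc₁]
  have hc₃sq : c₃ ^ 2 ≤ c₂ ^ 2 := pow_le_pow_left₀ h30 h3₂ 2
  have hhalfc₂ : 1 / 2 ≤ c₂ := by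
    have h : (1 / 2 : ℝ) ^ 2 ≤ c₂ ^ 2 := by linarith only [hQ, hc₃sq]
    exact (pow_le_pow_iff_left₀ (by norm_num) hc₂0 two_ne_zero).1 h
  refine ⟨hhalfc₂, ?_⟩
  -- `c² ≥ 1/3`
  have hc13 : 1 / 3 ≤ c ^ 2 := by
    have h1 : c₁ * c₁ ≤ c₁ * (r * c / 2) := mul_le_mul_of_nonneg_left (by linarith only [hc₁']) hc₁0
    have h2 : c₂ * c₂ ≤ c₂ * (r * c / 2) := mul_le_mul_of_nonneg_left (by linarith only [hc₂']) hc₂0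
    have h3 : c₃ * c₃ ≤ c₃ * (r * c / 2) := mul_le_mul_of_nonneg_left (by linarith only [hc₂', h3₂]) h30
    have h4 : (c₁ + c₂ + c₃) * (r * c / 2) = 3 * c ^ 2 := by
      rw [hsum, show r * c * (r * c / 2) = r ^ 2 * c ^ 2 / 2 by ring, hr6]; ring
    nlinarith only [h1, h2, h3, h4, hsq]
  by_cases hbig : 2 / 3 ≤ c ^ 2
  · have hc₁sq : c₁ ^ 2 ≤ 1 := by nlinarith only [h1₁, hc₁0]
    linarith only [hsq, hc₁sq, hc₃sq, hbig]
  push Not at hbig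
  -- the gap `d = c₂ − c₃`
  set d : ℝ := c₂ - c₃ with hd
  have hd0 : 0 ≤ d := by rw [hd]; linarith only [h3₂]
  have hdsq : d ^ 2 = 1 - 3 * c ^ 2 + 2 * r * c * c₁ - 3 * c₁ ^ 2 := by
    have e1 : d ^ 2 = 2 * (c₂ ^ 2 + c₃ ^ 2) - (c₂ + c₃) ^ 2 := by rw [hd]; ring
    have e2 : c₂ + c₃ = r * c - c₁ := by linarith only [hsum]
    have e3 : c₂ ^ 2 + c₃ ^ 2 = (1 + 3 * c ^ 2) / 2 - c₁ ^ 2 := by linarith only [hsq]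
    rw [e1, e2, e3]; linear_combination (-c ^ 2) * hr6
  have hc₁lo : r * c / 4 ≤ c₁ := by linarith only [hc₂', h3₁, hsum]
  have hD : 1 - 3 / 2 * c ^ 2 ≤ d ^ 2 := by
    have hprod : 0 ≤ (r * c / 2 - c₁) * (3 * c₁ - r * c / 2) :=
      mul_nonneg (by linarith only [hc₁']) (by linarith only [hc₁lo, hrc])
    have e : d ^ 2 - (1 - 3 / 2 * c ^ 2) = (r * c / 2 - c₁) * (3 * c₁ - r * c / 2) := by
      rw [hdsq]; linear_combination (c ^ 2 / 4) * hr6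
    linarith only [hprod, e]
  -- `2c₂² = Q + (c₂ + c₃)d ≥ 1/2 + (r c/2)·d`
  have h2c₂ : 2 * c₂ ^ 2 = (c₂ ^ 2 + c₃ ^ 2) + (c₂ + c₃) * d := by rw [hd]; ring
  have hS : r * c / 2 ≤ c₂ + c₃ := by linarith only [hc₁', hsum]
  have hmain : 1 / 2 + r * c / 2 * d ≤ 2 * c₂ ^ 2 := by
    rw [h2c₂]; linarith only [hQ, mul_le_mul_of_nonneg_right hS hd0]
  have hpos : 0 ≤ r * c / 2 * d := by positivity
  by_cases hhalf : 1 / 2 ≤ c ^ 2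
  · linarith only [hmain, hhalf, hpos]
  push Not at hhalf
  have hsq2 : (1 / 2 - c ^ 2) ^ 2 ≤ (r * c / 2 * d) ^ 2 := by
    have e : (r * c / 2 * d) ^ 2 = 3 / 2 * c ^ 2 * d ^ 2 := by
      rw [show (r * c / 2 * d) ^ 2 = r ^ 2 * c ^ 2 * d ^ 2 / 4 by ring, hr6]; ring
    rw [e]
    have h13 : 13 * (c ^ 2) ^ 2 - 10 * c ^ 2 + 1 ≤ 0 := by
      nlinarith only [mul_nonneg (sub_nonneg.2 hc13) (sub_nonneg.2 hhalf.le)]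
    have hc2 : (0 : ℝ) ≤ 3 / 2 * c ^ 2 := by positivity
    nlinarith only [mul_le_mul_of_nonneg_left hD hc2, h13]
  have hle : 1 / 2 - c ^ 2 ≤ r * c / 2 * d :=
    (pow_le_pow_iff_left₀ (by linarith only [hhalf]) hpos two_ne_zero).1 hsq2
  linarith only [hmain, hle]

/-! ### Two good rising slots -/

/-- **Two of the three rising slots of `ν` are good** whenever all three have `e`-components in `[0, √(3/2)·⟪ν,e⟫]`:
`e`-component `≥ ½` and `1 − ⟪ν,e⟫² ≤ 2·⟪w,e⟫²` (the slot dominates `ν`). -/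
theorem two_good_rising_slots {w₁ w₂ w₃ ν e : EuclideanSpace ℝ (Fin 3)}
    (h₁ : ‖w₁‖ = 1) (h₂ : ‖w₂‖ = 1) (h₃ : ‖w₃‖ = 1) (hν : ‖ν‖ = 1) (he : ‖e‖ = 1)
    (h₁₂ : ⟪w₁, w₂⟫_ℝ = 1 / 2) (h₁₃ : ⟪w₁, w₃⟫_ℝ = 1 / 2) (h₂₃ : ⟪w₂, w₃⟫_ℝ = 1 / 2)
    (hn₁ : ⟪w₁, ν⟫_ℝ = Real.sqrt (2 / 3)) (hn₂ : ⟪w₂, ν⟫_ℝ = Real.sqrt (2 / 3)) (hn₃ : ⟪w₃, ν⟫_ℝ = Real.sqrt (2 / 3))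
    (hc : 0 ≤ ⟪ν, e⟫_ℝ) (hlo : 0 ≤ ⟪w₁, e⟫_ℝ ∧ 0 ≤ ⟪w₂, e⟫_ℝ ∧ 0 ≤ ⟪w₃, e⟫_ℝ)
    (hhi : 2 * ⟪w₁, e⟫_ℝ ^ 2 ≤ 3 * ⟪ν, e⟫_ℝ ^ 2 ∧ 2 * ⟪w₂, e⟫_ℝ ^ 2 ≤ 3 * ⟪ν, e⟫_ℝ ^ 2 ∧
      2 * ⟪w₃, e⟫_ℝ ^ 2 ≤ 3 * ⟪ν, e⟫_ℝ ^ 2) :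
    ∃ wᵢ wⱼ : EuclideanSpace ℝ (Fin 3), ((wᵢ = w₁ ∧ wⱼ = w₂) ∨ (wᵢ = w₁ ∧ wⱼ = w₃) ∨ (wᵢ = w₂ ∧ wⱼ = w₃)) ∧
      (1 / 2 ≤ ⟪wᵢ, e⟫_ℝ ∧ 1 - ⟪ν, e⟫_ℝ ^ 2 ≤ 2 * ⟪wᵢ, e⟫_ℝ ^ 2) ∧
      (1 / 2 ≤ ⟪wⱼ, e⟫_ℝ ∧ 1 - ⟪ν, e⟫_ℝ ^ 2 ≤ 2 * ⟪wⱼ, e⟫_ℝ ^ 2) := by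
  have hsq := sum_sq_inner_cappers h₁ h₂ h₃ hν he h₁₂ h₁₃ h₂₃ hn₁ hn₂ hn₃
  have hsumv := sum_eq_sqrt_six_smul w₁ w₂ w₃ ν h₁ h₂ h₃ hν h₁₂ h₁₃ h₂₃ hn₁ hn₂ hn₃
  have hsum : ⟪w₁, e⟫_ℝ + ⟪w₂, e⟫_ℝ + ⟪w₃, e⟫_ℝ = Real.sqrt 6 * ⟪ν, e⟫_ℝ := by
    have := congrArg (fun v => ⟪v, e⟫_ℝ) hsumv
    simp only [inner_add_left, real_inner_smul_left] at this
    exact this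
  have hle1 : ∀ w : EuclideanSpace ℝ (Fin 3), ‖w‖ = 1 → ⟪w, e⟫_ℝ ≤ 1 := by
    intro w hw; have := real_inner_le_norm w e; rw [hw, he, one_mul] at this; exact this
  obtain ⟨hl₁, hl₂, hl₃⟩ := hlo
  obtain ⟨hh₁, hh₂, hh₃⟩ := hhi
  set c := ⟪ν, e⟫_ℝ
  set c₁ := ⟪w₁, e⟫_ℝ
  set c₂ := ⟪w₂, e⟫_ℝ
  set c₃ := ⟪w₃, e⟫_ℝ
  have hsq' : c₁ ^ 2 + c₂ ^ 2 + c₃ ^ 2 = (1 + 3 * c ^ 2) / 2 := hsq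
  by_cases hA : c₃ ≤ c₁ ∧ c₃ ≤ c₂
  · refine ⟨w₁, w₂, Or.inl ⟨rfl, rfl⟩, ?_, ?_⟩
    · exact two_good_of_moments hc hA.2 hA.1 hl₃ (hle1 w₂ h₂) hh₂ hh₁ (by linarith) (by linarith)
    · exact two_good_of_moments hc hA.1 hA.2 hl₃ (hle1 w₁ h₁) hh₁ hh₂ hsum hsq'
  by_cases hB : c₂ ≤ c₁ ∧ c₂ ≤ c₃
  · refine ⟨w₁, w₃, Or.inr (Or.inl ⟨rfl, rfl⟩), ?_, ?_⟩
    · exact two_good_of_moments hc hB.2 hB.1 hl₂ (hle1 w₃ h₃) hh₃ hh₁ (by linarith) (by linarith)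
    · exact two_good_of_moments hc hB.1 hB.2 hl₂ (hle1 w₁ h₁) hh₁ hh₃ (by linarith) (by linarith)
  have hC : c₁ ≤ c₂ ∧ c₁ ≤ c₃ := by
    rw [not_and_or, not_le, not_le] at hA hB
    constructor
    · by_contra h
      rw [not_le] at h
      -- `c₂ < c₁`: then `hB` forces `c₃ < c₂`, and `hA` forces `c₂ < c₃`
      have h32 : c₃ < c₂ := by
        rcases hB with h' | h'
        · exact absurd h' (not_lt.2 h.le)
        · exact h'
      rcases hA with h' | h'
      · exact absurd h' (not_lt.2 (h32.trans h).le)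
      · exact absurd h' (not_lt.2 h32.le)
    · by_contra h
      rw [not_le] at h
      have h23 : c₂ < c₃ := by
        rcases hA with h' | h'
        · exact absurd h' (not_lt.2 h.le)
        · exact h'
      rcases hB with h' | h'
      · exact absurd h' (not_lt.2 (h23.trans h).le)
      · exact absurd h' (not_lt.2 h23.le)
  refine ⟨w₂, w₃, Or.inr (Or.inr ⟨rfl, rfl⟩), ?_, ?_⟩
  · exact two_good_of_moments hc hC.2 hC.1 hl₁ (hle1 w₃ h₃) hh₃ hh₂ (by linarith) (by linarith)
  · exact two_good_of_moments hc hC.1 hC.2 hl₁ (hle1 w₂ h₂) hh₂ hh₃ (by linarith) (by linarith)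

end Summit.Ventures.Crystal3D.Theorems

end
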